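import Summits.KontsevichZagierPeriods.KontsevichZagierPeriods.Theorems.HermiteRigidityIslandComplementBoxLanden

/-!
# `ReductionRigidity` (stmt-KontsevichZagierPeriods-3407), line `Sketch`, growth line
# `bloch-suslin-rational-dilog`: Euler's reflection combination is independent of the rational point
# (`stub_eulerDeformation`)

Route `KontsevichZagierPeriods/HermiteRigidity`, crux `ReductionRigidity` (stmt-3407), registered
worker stub `stub_eulerDeformation` (input of the lead's rational Rogers five-term transfer
`stub_neumannTransfer`). EULER'S REFLECTION `Li₂(x) + Li₂(1−x) + log x · log(1−x) = ζ(2)` inside the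
Kontsevich–Zagier calculus, in the form: the combination

  `E(x) = [□², x/(1−xpq)] + [□², (1−x)/(1−(1−x)pq)] + [□², ((x−1)/(1+(x−1)p))·((−x)/(1−xq))]`

(values `Li₂(x)`, `Li₂(1−x)`, `log x · log(1−x)`) satisfies `E(x) − E(x') ∈ KZ.relations` for all
rationals `x, x' ∈ (0,1)`. Mechanism (deformation Stokes, as for `stub_boxLanden` and
`stub_boxFiveTerm`): put `s(t) = x + (x'−x)t`, `t ∈ [0,1]`, on the third cube coordinate; the
three integrands become regular rational functions on `□³` (coordinates `p = p₀`, `q = p₁`,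
`t = p₂`)

  `K₁ = s/(1 − spq)`, `K₂ = (1−s)/(1 − (1−s)pq)`, `K₃ = ((s−1)/(1+(s−1)p))·((−s)/(1−sq))`,

whose faces `t = 0` / `t = 1` are `E(x)` / `E(x')`. Three Stokes moves in `t` turn
`E(x') − E(x)` into `Σᵢ [□³, ∂ₜKᵢ]`, and with `c = x' − x` one has the EXACTNESS

  `∂ₜK₁ = ∂ₚA₁`, `A₁ = cp/(1 − spq)`;  `∂ₜK₂ = ∂ₚA₂`, `A₂ = −cp/(1 − (1−s)pq)`;
  `∂ₜK₃ = ∂ₚA₃ + ∂_qB₃`, `A₃ = −cps/((1+(s−1)p)(1−sq))`, `B₃ = −cq(s−1)/((1+(s−1)p)(1−sq))`.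

Four more Stokes moves (in `p` for `Aᵢ`, in `q` for `B₃`): the faces `p = 0` / `q = 0` vanish and
the four faces `p = 1` / `q = 1` (`c/(1−su)`, `−c/(1−(1−s)u)`, `−c/(1−su)`, `c/(1−(1−s)u)` as
functions of `(u, t)`) cancel pointwise. Bookkeeping on `χ`-values for an arbitrary additive `χ`
killing `KZ.relations` (`eulerDef_chi`), then specialised to the quotient map onto the formal period
ring `FormalRep ⧸ relations`.

References: M. Kontsevich, D. Zagier, *Periods* (2001), §1.2 rules (1)–(3)
[cite: KontsevichZagier2001, §1.2]; D. Zagier, *The dilogarithm function* (2007), Ch. I §2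
[cite: Zagier2007Dilogarithm, Ch. I §2]. No definitions are introduced.
-/

noncomputable section

open MeasureTheory Set MvPolynomial

namespace Summit.KontsevichZagierPeriods.HermiteRigidity.ReductionRigidity

open Literature.NumberTheory.Transcendental
open Literature.NumberTheory.Transcendental.KZ

/-! ## Bounds on the closed cubes -/

/-- The deformation parameter `s(t) = x + (x'−x)t` stays in `(0,1)` for `t ∈ [0,1]`. [folklore] -/
theorem eulerDef_s_bounds {x x' : ℚ} (hx : 0 < x) (hx1 : x < 1) (hx' : 0 < x') (hx'1 : x' < 1)
    {t : ℝ} (ht0 : 0 ≤ t) (ht1 : t ≤ 1) :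
    0 < (x:ℝ) + ((x':ℝ) - x) * t ∧ (x:ℝ) + ((x':ℝ) - x) * t < 1 := by
  have hxR : (0:ℝ) < x := by exact_mod_cast hx
  have hx1R : (x:ℝ) < 1 := by exact_mod_cast hx1
  have hx'R : (0:ℝ) < x' := by exact_mod_cast hx'
  have hx'1R : (x':ℝ) < 1 := by exact_mod_cast hx'1
  rcases le_total (x:ℝ) x' with h | h
  · constructor <;> nlinarith [mul_nonneg (sub_nonneg.2 h) ht0,
      mul_nonneg (sub_nonneg.2 h) (sub_nonneg.2 ht1)]
  · constructor <;> nlinarith [mul_nonneg (sub_nonneg.2 h) ht0,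
      mul_nonneg (sub_nonneg.2 h) (sub_nonneg.2 ht1)]

/-- On `□³` the four denominators `1 − spq`, `1 − (1−s)pq`, `1 + (s−1)p`, `1 − sq` are positive and
`0 < s < 1` (`s = x + (x'−x)t`). [folklore] -/
theorem eulerDef_den_pos {x x' : ℚ} (hx : 0 < x) (hx1 : x < 1) (hx' : 0 < x') (hx'1 : x' < 1)
    {p : Fin 3 → ℝ} (hp : p ∈ cube 3) :
    0 < 1 - ((x:ℝ) + ((x':ℝ) - x) * p 2) * p 0 * p 1 ∧
      0 < 1 - (1 - ((x:ℝ) + ((x':ℝ) - x) * p 2)) * p 0 * p 1 ∧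
      0 < 1 + (((x:ℝ) + ((x':ℝ) - x) * p 2) - 1) * p 0 ∧
      0 < 1 - ((x:ℝ) + ((x':ℝ) - x) * p 2) * p 1 ∧
      0 < (x:ℝ) + ((x':ℝ) - x) * p 2 ∧ (x:ℝ) + ((x':ℝ) - x) * p 2 < 1 := by
  obtain ⟨hs0, hs1⟩ := eulerDef_s_bounds hx hx1 hx' hx'1 (hp 2).1 (hp 2).2
  have h0 := hp 0; have h1 := hp 1
  have h01 : 0 ≤ p 0 * p 1 ∧ p 0 * p 1 ≤ 1 := ⟨mul_nonneg h0.1 h1.1, mul_le_one₀ h0.2 h1.1 h1.2⟩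
  refine ⟨?_, ?_, ?_, ?_, hs0, hs1⟩
  · nlinarith [mul_le_mul_of_nonneg_left h01.2 hs0.le]
  · nlinarith [mul_le_mul_of_nonneg_left h01.2 (sub_nonneg.2 hs1.le)]
  · nlinarith [mul_le_mul_of_nonneg_left h0.2 (sub_nonneg.2 hs1.le)]
  · nlinarith [mul_le_mul_of_nonneg_left h1.2 hs0.le]

/-- On `□²` (coordinates `u = u₀`, `t = u₁`): `0 < s < 1`, `1 − su > 0`, `1 − (1−s)u > 0`
(`s = x + (x'−x)t`). [folklore] -/
theorem eulerDef_face_den_pos {x x' : ℚ} (hx : 0 < x) (hx1 : x < 1) (hx' : 0 < x')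
    (hx'1 : x' < 1) {u : Fin 2 → ℝ} (hu : u ∈ cube 2) :
    0 < (x:ℝ) + ((x':ℝ) - x) * u 1 ∧ (x:ℝ) + ((x':ℝ) - x) * u 1 < 1 ∧
      0 < 1 - ((x:ℝ) + ((x':ℝ) - x) * u 1) * u 0 ∧
      0 < 1 - (1 - ((x:ℝ) + ((x':ℝ) - x) * u 1)) * u 0 := by
  obtain ⟨hs0, hs1⟩ := eulerDef_s_bounds hx hx1 hx' hx'1 (hu 1).1 (hu 1).2
  have h0 := hu 0
  refine ⟨hs0, hs1, ?_, ?_⟩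
  · nlinarith [mul_le_mul_of_nonneg_left h0.2 hs0.le]
  · nlinarith [mul_le_mul_of_nonneg_left h0.2 (sub_nonneg.2 hs1.le)]

/-! ## The three kernels and their four primitives on `□³` -/

/-- `K₁ = s/(1 − spq)` and `A₁ = cp/(1 − spq)` on `□³` (`s = x + ct`, `c = x' − x`), with
`∂ₜK₁ = ∂ₚA₁ = c/(1 − spq)²`. [cite: KontsevichZagier2001, §1.1] -/
theorem exists_eulerDef_KA₁ {x x' : ℚ} (hx : 0 < x) (hx1 : x < 1) (hx' : 0 < x')
    (hx'1 : x' < 1) : ∃ K A : RFun 3,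
      (∀ p ∈ cube 3, K.fn p = ((x:ℝ) + ((x':ℝ) - x) * p 2) /
        (1 - ((x:ℝ) + ((x':ℝ) - x) * p 2) * p 0 * p 1)) ∧
      (∀ p ∈ cube 3, (K.pd 2).fn p = ((x':ℝ) - x) /
        (1 - ((x:ℝ) + ((x':ℝ) - x) * p 2) * p 0 * p 1) ^ 2) ∧
      (∀ p ∈ cube 3, A.fn p = ((x':ℝ) - x) * p 0 /
        (1 - ((x:ℝ) + ((x':ℝ) - x) * p 2) * p 0 * p 1)) ∧
      (∀ p ∈ cube 3, (A.pd 0).fn p = ((x':ℝ) - x) /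
        (1 - ((x:ℝ) + ((x':ℝ) - x) * p 2) * p 0 * p 1) ^ 2) := by
  have hden : ∀ p ∈ cube 3,
      aeval p (1 - (C x + C (x' - x) * X 2) * X 0 * X 1 : MvPolynomial (Fin 3) ℚ) ≠ 0 := by
    intro p hp
    have h := (eulerDef_den_pos hx hx1 hx' hx'1 hp).1
    simp only [map_sub, map_one, map_mul, map_add, aeval_C, aeval_X, eq_ratCast]
    exact h.ne'
  refine ⟨⟨C x + C (x' - x) * X 2, _, hden⟩, ⟨C (x' - x) * X 0, _, hden⟩,
    fun p _ => by simp [RFun.fn_apply], fun p hp => ?_, fun p _ => by simp [RFun.fn_apply],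
    fun p hp => ?_⟩
  all_goals
    have hne := (eulerDef_den_pos hx hx1 hx' hx'1 hp).1.ne'
    rw [rfun_pd_fn_eq]
    simp only [map_sub, map_one, map_mul, map_add, pderiv_mul, pderiv_C, pderiv_one, pderiv_X,
      aeval_C, aeval_X, eq_ratCast]
    norm_num [Pi.single_apply, Fin.ext_iff]
    field_simp
    ring

/-- `K₂ = (1−s)/(1 − (1−s)pq)` and `A₂ = −cp/(1 − (1−s)pq)` on `□³`, with
`∂ₜK₂ = ∂ₚA₂ = −c/(1 − (1−s)pq)²`. [cite: KontsevichZagier2001, §1.1] -/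
theorem exists_eulerDef_KA₂ {x x' : ℚ} (hx : 0 < x) (hx1 : x < 1) (hx' : 0 < x')
    (hx'1 : x' < 1) : ∃ K A : RFun 3,
      (∀ p ∈ cube 3, K.fn p = (1 - ((x:ℝ) + ((x':ℝ) - x) * p 2)) /
        (1 - (1 - ((x:ℝ) + ((x':ℝ) - x) * p 2)) * p 0 * p 1)) ∧
      (∀ p ∈ cube 3, (K.pd 2).fn p = -((x':ℝ) - x) /
        (1 - (1 - ((x:ℝ) + ((x':ℝ) - x) * p 2)) * p 0 * p 1) ^ 2) ∧
      (∀ p ∈ cube 3, A.fn p = -(((x':ℝ) - x) * p 0) /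
        (1 - (1 - ((x:ℝ) + ((x':ℝ) - x) * p 2)) * p 0 * p 1)) ∧
      (∀ p ∈ cube 3, (A.pd 0).fn p = -((x':ℝ) - x) /
        (1 - (1 - ((x:ℝ) + ((x':ℝ) - x) * p 2)) * p 0 * p 1) ^ 2) := by
  have hden : ∀ p ∈ cube 3, aeval p
      (1 - (1 - (C x + C (x' - x) * X 2)) * X 0 * X 1 : MvPolynomial (Fin 3) ℚ) ≠ 0 := by
    intro p hp
    have h := (eulerDef_den_pos hx hx1 hx' hx'1 hp).2.1
    simp only [map_sub, map_one, map_mul, map_add, aeval_C, aeval_X, eq_ratCast]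
    exact h.ne'
  refine ⟨⟨1 - (C x + C (x' - x) * X 2), _, hden⟩, ⟨-(C (x' - x) * X 0), _, hden⟩,
    fun p _ => by simp [RFun.fn_apply], fun p hp => ?_, fun p _ => by simp [RFun.fn_apply],
    fun p hp => ?_⟩
  all_goals
    have hne := (eulerDef_den_pos hx hx1 hx' hx'1 hp).2.1.ne'
    rw [rfun_pd_fn_eq]
    simp only [map_sub, map_one, map_mul, map_add, map_neg, pderiv_mul, pderiv_C, pderiv_one,
      pderiv_X, aeval_C, aeval_X, eq_ratCast]
    norm_num [Pi.single_apply, Fin.ext_iff]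
    field_simp
    ring

/-- `K₃ = ((s−1)/(1+(s−1)p))·((−s)/(1−sq))`, `A₃ = −cps/((1+(s−1)p)(1−sq))`,
`B₃ = −cq(s−1)/((1+(s−1)p)(1−sq))` on `□³`, with `∂ₜK₃ = ∂ₚA₃ + ∂_qB₃`,
`∂ₚA₃ = −cs/((1+(s−1)p)²(1−sq))`, `∂_qB₃ = −c(s−1)/((1+(s−1)p)(1−sq)²)`.
[cite: KontsevichZagier2001, §1.1] -/
theorem exists_eulerDef_KAB₃ {x x' : ℚ} (hx : 0 < x) (hx1 : x < 1) (hx' : 0 < x')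
    (hx'1 : x' < 1) : ∃ K A B : RFun 3,
      (∀ p ∈ cube 3, K.fn p = ((((x:ℝ) + ((x':ℝ) - x) * p 2) - 1) /
          (1 + (((x:ℝ) + ((x':ℝ) - x) * p 2) - 1) * p 0)) *
        (-((x:ℝ) + ((x':ℝ) - x) * p 2) / (1 - ((x:ℝ) + ((x':ℝ) - x) * p 2) * p 1))) ∧
      (∀ p ∈ cube 3, (K.pd 2).fn p =
        -(((x':ℝ) - x) * ((x:ℝ) + ((x':ℝ) - x) * p 2)) /
            ((1 + (((x:ℝ) + ((x':ℝ) - x) * p 2) - 1) * p 0) ^ 2 *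
              (1 - ((x:ℝ) + ((x':ℝ) - x) * p 2) * p 1)) +
          -(((x':ℝ) - x) * (((x:ℝ) + ((x':ℝ) - x) * p 2) - 1)) /
            ((1 + (((x:ℝ) + ((x':ℝ) - x) * p 2) - 1) * p 0) *
              (1 - ((x:ℝ) + ((x':ℝ) - x) * p 2) * p 1) ^ 2)) ∧
      (∀ p ∈ cube 3, A.fn p = -(((x':ℝ) - x) * p 0 * ((x:ℝ) + ((x':ℝ) - x) * p 2)) /
        ((1 + (((x:ℝ) + ((x':ℝ) - x) * p 2) - 1) * p 0) *
          (1 - ((x:ℝ) + ((x':ℝ) - x) * p 2) * p 1))) ∧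
      (∀ p ∈ cube 3, (A.pd 0).fn p =
        -(((x':ℝ) - x) * ((x:ℝ) + ((x':ℝ) - x) * p 2)) /
          ((1 + (((x:ℝ) + ((x':ℝ) - x) * p 2) - 1) * p 0) ^ 2 *
            (1 - ((x:ℝ) + ((x':ℝ) - x) * p 2) * p 1))) ∧
      (∀ p ∈ cube 3, B.fn p = -(((x':ℝ) - x) * p 1 * (((x:ℝ) + ((x':ℝ) - x) * p 2) - 1)) /
        ((1 + (((x:ℝ) + ((x':ℝ) - x) * p 2) - 1) * p 0) *
          (1 - ((x:ℝ) + ((x':ℝ) - x) * p 2) * p 1))) ∧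
      (∀ p ∈ cube 3, (B.pd 1).fn p =
        -(((x':ℝ) - x) * (((x:ℝ) + ((x':ℝ) - x) * p 2) - 1)) /
          ((1 + (((x:ℝ) + ((x':ℝ) - x) * p 2) - 1) * p 0) *
            (1 - ((x:ℝ) + ((x':ℝ) - x) * p 2) * p 1) ^ 2)) := by
  have hden : ∀ p ∈ cube 3, aeval p
      ((1 + ((C x + C (x' - x) * X 2) - 1) * X 0) * (1 - (C x + C (x' - x) * X 2) * X 1) :
        MvPolynomial (Fin 3) ℚ) ≠ 0 := by
    intro p hp
    have h := eulerDef_den_pos hx hx1 hx' hx'1 hp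
    simp only [map_sub, map_one, map_mul, map_add, aeval_C, aeval_X, eq_ratCast]
    exact mul_ne_zero h.2.2.1.ne' h.2.2.2.1.ne'
  refine ⟨⟨((C x + C (x' - x) * X 2) - 1) * -(C x + C (x' - x) * X 2), _, hden⟩,
    ⟨-(C (x' - x) * X 0 * (C x + C (x' - x) * X 2)), _, hden⟩,
    ⟨-(C (x' - x) * X 1 * ((C x + C (x' - x) * X 2) - 1)), _, hden⟩,
    fun p _ => by
      rw [div_mul_div_comm]
      simp only [RFun.fn_apply, map_sub, map_one, map_mul, map_add, map_neg, aeval_C, aeval_X,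
        eq_ratCast],
    fun p hp => ?_,
    fun p _ => by
      simp only [RFun.fn_apply, map_sub, map_one, map_mul, map_add, map_neg, aeval_C, aeval_X,
        eq_ratCast],
    fun p hp => ?_,
    fun p _ => by
      simp only [RFun.fn_apply, map_sub, map_one, map_mul, map_add, map_neg, aeval_C, aeval_X,
        eq_ratCast],
    fun p hp => ?_⟩
  all_goals
    have h := eulerDef_den_pos hx hx1 hx' hx'1 hp
    have h1 := h.2.2.1.ne'
    have h2 := h.2.2.2.1.ne'
    rw [rfun_pd_fn_eq]
    simp only [map_sub, map_one, map_mul, map_add, map_neg, pderiv_mul, pderiv_C, pderiv_one,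
      pderiv_X, aeval_C, aeval_X, eq_ratCast]
    norm_num [Pi.single_apply, Fin.ext_iff]
    field_simp
    ring

/-! ## The chain of moves, on `χ`-values -/

section Chi

variable {R : Type} [CommRing R] {χ : KZ.FormalRep →+ R}
variable (hrel : ∀ c ∈ KZ.relations, χ c = 0)
include hrel

/-- **Euler's reflection combination is independent of the rational point, `χ`-form**: for every
additive `χ` killing `KZ.relations` and rationals `x, x' ∈ (0,1)`, `χ E(x) = χ E(x')` for
`E(x) = [x/(1−xpq)] + [(1−x)/(1−(1−x)pq)] + [((x−1)/(1+(x−1)p))·((−x)/(1−xq))]`. Seven Stokes moves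
(`RFun.chi_stokesAt`), the exactness `∂ₜK₁ = ∂ₚA₁`, `∂ₜK₂ = ∂ₚA₂`, `∂ₜK₃ = ∂ₚA₃ + ∂_qB₃` and the
pointwise cancellation of the four surviving faces.
[cite: KontsevichZagier2001, §1.2 rules (1)–(3)] -/
theorem eulerDef_chi {x x' : ℚ} (hx : 0 < x) (hx1 : x < 1) (hx' : 0 < x') (hx'1 : x' < 1)
    (r₁ r₂ r₃ s₁ s₂ s₃ : IntegralRep 2)
    (hr₁ : r₁.domain = cube 2)
    (hr₁i : EqOn r₁.integrand (fun p => (x : ℝ) / (1 - (x : ℝ) * p 0 * p 1)) (cube 2))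
    (hr₂ : r₂.domain = cube 2)
    (hr₂i : EqOn r₂.integrand
      (fun p => (((1 - x : ℚ)) : ℝ) / (1 - ((1 - x : ℚ) : ℝ) * p 0 * p 1)) (cube 2))
    (hr₃ : r₃.domain = cube 2)
    (hr₃i : EqOn r₃.integrand (fun p => (((x : ℝ) - 1) / (1 + ((x : ℝ) - 1) * p 0)) *
      ((-(x : ℝ)) / (1 - (x : ℝ) * p 1))) (cube 2))
    (hs₁ : s₁.domain = cube 2)
    (hs₁i : EqOn s₁.integrand (fun p => (x' : ℝ) / (1 - (x' : ℝ) * p 0 * p 1)) (cube 2))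
    (hs₂ : s₂.domain = cube 2)
    (hs₂i : EqOn s₂.integrand
      (fun p => (((1 - x' : ℚ)) : ℝ) / (1 - ((1 - x' : ℚ) : ℝ) * p 0 * p 1)) (cube 2))
    (hs₃ : s₃.domain = cube 2)
    (hs₃i : EqOn s₃.integrand (fun p => (((x' : ℝ) - 1) / (1 + ((x' : ℝ) - 1) * p 0)) *
      ((-(x' : ℝ)) / (1 - (x' : ℝ) * p 1))) (cube 2)) :
    χ (KZ.of r₁) + χ (KZ.of r₂) + χ (KZ.of r₃) -
      (χ (KZ.of s₁) + χ (KZ.of s₂) + χ (KZ.of s₃)) = 0 := by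
  obtain ⟨K₁, A₁, hK₁, hK₁', hA₁, hA₁'⟩ := exists_eulerDef_KA₁ hx hx1 hx' hx'1
  obtain ⟨K₂, A₂, hK₂, hK₂', hA₂, hA₂'⟩ := exists_eulerDef_KA₂ hx hx1 hx' hx'1
  obtain ⟨K₃, A₃, B₃, hK₃, hK₃', hA₃, hA₃', hB₃, hB₃'⟩ := exists_eulerDef_KAB₃ hx hx1 hx' hx'1
  have h1 : (0:ℚ) ≤ 1 ∧ (1:ℚ) ≤ 1 := ⟨zero_le_one, le_rfl⟩
  have h0 : (0:ℚ) ≤ 0 ∧ (0:ℚ) ≤ 1 := ⟨le_rfl, zero_le_one⟩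
  have m1 : ∀ (i : Fin 3) {u : Fin 2 → ℝ}, u ∈ cube 2 →
      (Fin.insertNth i (((1:ℚ):ℝ)) u : Fin 3 → ℝ) ∈ cube 3 :=
    fun i u hu => insertNth_mem_cube i (by norm_num) hu
  have m0 : ∀ (i : Fin 3) {u : Fin 2 → ℝ}, u ∈ cube 2 →
      (Fin.insertNth i (((0:ℚ):ℝ)) u : Fin 3 → ℝ) ∈ cube 3 :=
    fun i u hu => insertNth_mem_cube i (by norm_num) hu
  -- the six squares are the faces `t = 0` (point `x`) and `t = 1` (point `x'`) of `K₁, K₂, K₃`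
  have cr₁ : χ (KZ.of r₁) = (K₁.faceAt 2 0 h0).chi χ :=
    rfun_chi_of_eq hrel _ hr₁ fun u hu => by
      rw [hr₁i hu, RFun.fn_faceAt, hK₁ _ (m0 2 hu), insertNth_two_apply_zero,
        insertNth_two_apply_one, insertNth_two_apply_two]; push_cast; ring
  have cs₁ : χ (KZ.of s₁) = (K₁.faceAt 2 1 h1).chi χ :=
    rfun_chi_of_eq hrel _ hs₁ fun u hu => by
      rw [hs₁i hu, RFun.fn_faceAt, hK₁ _ (m1 2 hu), insertNth_two_apply_zero,
        insertNth_two_apply_one, insertNth_two_apply_two]; push_cast; ring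
  have cr₂ : χ (KZ.of r₂) = (K₂.faceAt 2 0 h0).chi χ :=
    rfun_chi_of_eq hrel _ hr₂ fun u hu => by
      rw [hr₂i hu, RFun.fn_faceAt, hK₂ _ (m0 2 hu), insertNth_two_apply_zero,
        insertNth_two_apply_one, insertNth_two_apply_two]; push_cast; ring
  have cs₂ : χ (KZ.of s₂) = (K₂.faceAt 2 1 h1).chi χ :=
    rfun_chi_of_eq hrel _ hs₂ fun u hu => by
      rw [hs₂i hu, RFun.fn_faceAt, hK₂ _ (m1 2 hu), insertNth_two_apply_zero,
        insertNth_two_apply_one, insertNth_two_apply_two]; push_cast; ring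
  have cr₃ : χ (KZ.of r₃) = (K₃.faceAt 2 0 h0).chi χ :=
    rfun_chi_of_eq hrel _ hr₃ fun u hu => by
      rw [hr₃i hu, RFun.fn_faceAt, hK₃ _ (m0 2 hu), insertNth_two_apply_zero,
        insertNth_two_apply_one, insertNth_two_apply_two]; push_cast; ring
  have cs₃ : χ (KZ.of s₃) = (K₃.faceAt 2 1 h1).chi χ :=
    rfun_chi_of_eq hrel _ hs₃ fun u hu => by
      rw [hs₃i hu, RFun.fn_faceAt, hK₃ _ (m1 2 hu), insertNth_two_apply_zero,
        insertNth_two_apply_one, insertNth_two_apply_two]; push_cast; ring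
  -- the faces `p = 0` of `A₁, A₂, A₃` and `q = 0` of `B₃` vanish
  have bA₁ : (A₁.faceAt 0 0 h0).chi χ = 0 := RFun.chi_eq_zero hrel fun u hu => by
    rw [RFun.fn_faceAt, hA₁ _ (m0 0 hu), insertNth_zero_apply_zero]; push_cast; ring
  have bA₂ : (A₂.faceAt 0 0 h0).chi χ = 0 := RFun.chi_eq_zero hrel fun u hu => by
    rw [RFun.fn_faceAt, hA₂ _ (m0 0 hu), insertNth_zero_apply_zero]; push_cast; ring
  have bA₃ : (A₃.faceAt 0 0 h0).chi χ = 0 := RFun.chi_eq_zero hrel fun u hu => by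
    rw [RFun.fn_faceAt, hA₃ _ (m0 0 hu), insertNth_zero_apply_zero]; push_cast; ring
  have bB₃ : (B₃.faceAt 1 0 h0).chi χ = 0 := RFun.chi_eq_zero hrel fun u hu => by
    rw [RFun.fn_faceAt, hB₃ _ (m0 1 hu), insertNth_one_apply_one]; push_cast; ring
  -- the faces `p = 1` of `A₁, A₂, A₃` and `q = 1` of `B₃`, as functions of `(u, t) = (u₀, u₁)`
  have tA₁ : ∀ u ∈ cube 2, (A₁.faceAt 0 1 h1).fn u =
      ((x':ℝ) - x) / (1 - ((x:ℝ) + ((x':ℝ) - x) * u 1) * u 0) := by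
    intro u hu
    rw [RFun.fn_faceAt, hA₁ _ (m1 0 hu), insertNth_zero_apply_zero, insertNth_zero_apply_one,
      insertNth_zero_apply_two]; push_cast; ring
  have tA₂ : ∀ u ∈ cube 2, (A₂.faceAt 0 1 h1).fn u =
      -((x':ℝ) - x) / (1 - (1 - ((x:ℝ) + ((x':ℝ) - x) * u 1)) * u 0) := by
    intro u hu
    rw [RFun.fn_faceAt, hA₂ _ (m1 0 hu), insertNth_zero_apply_zero, insertNth_zero_apply_one,
      insertNth_zero_apply_two]; push_cast; ring
  have tA₃ : ∀ u ∈ cube 2, (A₃.faceAt 0 1 h1).fn u =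
      -(((x':ℝ) - x) * ((x:ℝ) + ((x':ℝ) - x) * u 1)) /
        (((x:ℝ) + ((x':ℝ) - x) * u 1) * (1 - ((x:ℝ) + ((x':ℝ) - x) * u 1) * u 0)) := by
    intro u hu
    rw [RFun.fn_faceAt, hA₃ _ (m1 0 hu), insertNth_zero_apply_zero, insertNth_zero_apply_one,
      insertNth_zero_apply_two]; push_cast; ring
  have tB₃ : ∀ u ∈ cube 2, (B₃.faceAt 1 1 h1).fn u =
      -(((x':ℝ) - x) * (((x:ℝ) + ((x':ℝ) - x) * u 1) - 1)) /
        ((1 + (((x:ℝ) + ((x':ℝ) - x) * u 1) - 1) * u 0) * (1 - ((x:ℝ) + ((x':ℝ) - x) * u 1))) := by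
    intro u hu
    rw [RFun.fn_faceAt, hB₃ _ (m1 1 hu), insertNth_one_apply_zero, insertNth_one_apply_one,
      insertNth_one_apply_two]; push_cast; ring
  -- the seven Stokes moves
  have sK₁ := RFun.chi_stokesAt hrel 2 K₁
  have sK₂ := RFun.chi_stokesAt hrel 2 K₂
  have sK₃ := RFun.chi_stokesAt hrel 2 K₃
  have sA₁ := RFun.chi_stokesAt hrel 0 A₁
  have sA₂ := RFun.chi_stokesAt hrel 0 A₂
  have sA₃ := RFun.chi_stokesAt hrel 0 A₃
  have sB₃ := RFun.chi_stokesAt hrel 1 B₃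
  -- exactness: `∂ₜK₁ = ∂ₚA₁`, `∂ₜK₂ = ∂ₚA₂`, `∂ₜK₃ = ∂ₚA₃ + ∂_qB₃`
  have e₁ : (K₁.pd 2).chi χ = (A₁.pd 0).chi χ :=
    RFun.chi_congr hrel fun p hp => by rw [hK₁' p hp, hA₁' p hp]
  have e₂ : (K₂.pd 2).chi χ = (A₂.pd 0).chi χ :=
    RFun.chi_congr hrel fun p hp => by rw [hK₂' p hp, hA₂' p hp]
  have e₃ : (K₃.pd 2).chi χ = (A₃.pd 0).chi χ + (B₃.pd 1).chi χ := by
    rw [← RFun.chi_add hrel]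
    exact RFun.chi_congr hrel fun p hp => by rw [RFun.fn_add hp, hK₃' p hp, hA₃' p hp, hB₃' p hp]
  -- the four surviving faces cancel pointwise
  have eU : ((((A₁.faceAt 0 1 h1).add (A₂.faceAt 0 1 h1)).add (A₃.faceAt 0 1 h1)).add
      (B₃.faceAt 1 1 h1)).chi χ = 0 := by
    refine RFun.chi_eq_zero hrel fun u hu => ?_
    obtain ⟨hs0, hs1, hd1, hd2⟩ := eulerDef_face_den_pos hx hx1 hx' hx'1 hu
    have hsne := hs0.ne'
    have hd1' := hd1.ne'
    have hd2' := hd2.ne'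
    have hs1' : 1 - ((x:ℝ) + ((x':ℝ) - x) * u 1) ≠ 0 := by linarith
    have hd3 : 1 + (((x:ℝ) + ((x':ℝ) - x) * u 1) - 1) * u 0 ≠ 0 := by nlinarith
    rw [RFun.fn_add hu, RFun.fn_add hu, RFun.fn_add hu, tA₁ u hu, tA₂ u hu, tA₃ u hu, tB₃ u hu]
    field_simp
    ring
  have eU' : ((((A₁.faceAt 0 1 h1).add (A₂.faceAt 0 1 h1)).add (A₃.faceAt 0 1 h1)).add
      (B₃.faceAt 1 1 h1)).chi χ = (A₁.faceAt 0 1 h1).chi χ + (A₂.faceAt 0 1 h1).chi χ +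
        (A₃.faceAt 0 1 h1).chi χ + (B₃.faceAt 1 1 h1).chi χ := by
    rw [RFun.chi_add hrel, RFun.chi_add hrel, RFun.chi_add hrel]
  linear_combination cr₁ + cr₂ + cr₃ - cs₁ - cs₂ - cs₃ + sK₁ + sK₂ + sK₃ - e₁ - e₂ - e₃ - sA₁ -
    sA₂ - sA₃ - sB₃ + bA₁ + bA₂ + bA₃ + bB₃ - eU + eU'

end Chi

/-! ## The registered stub -/

/-- **Stub `stub_eulerDeformation`** (worker stub W1 of crux `ReductionRigidity`, stmt-3407, line
`Sketch`, growth line `bloch-suslin-rational-dilog`): **Euler's reflection combination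
`[□², x/(1−xpq)] + [□², (1−x)/(1−(1−x)pq)] + [□², ((x−1)/(1+(x−1)p))·((−x)/(1−xq))]`
(`Li₂(x) + Li₂(1−x) + log x · log(1−x)`) is independent of the rational point `x ∈ (0,1)` modulo
`KZ.relations`**, for any representations on the closed square with the printed integrands:
`eulerDef_chi` for the quotient map onto the formal period ring `FormalRep ⧸ relations`.
[cite: Zagier2007Dilogarithm, Ch. I §2] -/
theorem stub_eulerDeformation : ∀ (x x' : ℚ), 0 < x → x < 1 → 0 < x' → x' < 1 →
    ∀ (r₁ r₂ r₃ s₁ s₂ s₃ : IntegralRep 2),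
      r₁.domain = cube 2 → EqOn r₁.integrand (fun p => (x : ℝ) / (1 - (x : ℝ) * p 0 * p 1)) (cube 2) →
      r₂.domain = cube 2 →
      EqOn r₂.integrand (fun p => (((1 - x : ℚ)) : ℝ) / (1 - ((1 - x : ℚ) : ℝ) * p 0 * p 1)) (cube 2) →
      r₃.domain = cube 2 →
      EqOn r₃.integrand (fun p => (((x : ℝ) - 1) / (1 + ((x : ℝ) - 1) * p 0)) *
        ((-(x : ℝ)) / (1 - (x : ℝ) * p 1))) (cube 2) →
      s₁.domain = cube 2 → EqOn s₁.integrand (fun p => (x' : ℝ) / (1 - (x' : ℝ) * p 0 * p 1)) (cube 2) →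
      s₂.domain = cube 2 →
      EqOn s₂.integrand (fun p => (((1 - x' : ℚ)) : ℝ) / (1 - ((1 - x' : ℚ) : ℝ) * p 0 * p 1)) (cube 2) →
      s₃.domain = cube 2 →
      EqOn s₃.integrand (fun p => (((x' : ℝ) - 1) / (1 + ((x' : ℝ) - 1) * p 0)) *
        ((-(x' : ℝ)) / (1 - (x' : ℝ) * p 1))) (cube 2) →
      (KZ.of r₁ + KZ.of r₂ + KZ.of r₃) - (KZ.of s₁ + KZ.of s₂ + KZ.of s₃) ∈ KZ.relations := by
  intro x x' hx hx1 hx' hx'1 r₁ r₂ r₃ s₁ s₂ s₃ hr₁ hr₁i hr₂ hr₂i hr₃ hr₃i hs₁ hs₁i hs₂ hs₂i hs₃ hs₃i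
  have h := eulerDef_chi (χ := (toFormalPeriod.toAddMonoidHom : FormalRep →+ FormalPeriodRing))
    (fun c hc => toFormalPeriod_eq_zero_of_mem hc) hx hx1 hx' hx'1 r₁ r₂ r₃ s₁ s₂ s₃ hr₁ hr₁i hr₂
    hr₂i hr₃ hr₃i hs₁ hs₁i hs₂ hs₂i hs₃ hs₃i
  rw [← toFormalPeriod_eq_zero_iff]
  simpa [map_add, map_sub] using h

end Summit.KontsevichZagierPeriods.HermiteRigidity.ReductionRigidity

end
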